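import Mathlib
import Summits.Ventures.Crystal3D.Theorems.StickyWulffConstantLayerChainDefs
import Summits.Ventures.Crystal3D.Theorems.StickyWulffConstantStackingLiminfSliceArea
import Summits.Ventures.Crystal3D.Theorems.StickyWulffConstantStackingLiminfSliceOuter
import Summits.Ventures.Crystal3D.Theorems.StickyWulffConstantStackingLiminfSliceInner
import HarnessLib

/-!
# Slicing the stacking Wulff bodies `W_f`: measurability, the Cavalieri identity, and the exact
# section areas (toward the banked `StackVolumeLaw` of line `LayerChain`, crux `StackingLiminf`,
# stmt-Ventures-19145)

Route `StickyWulffConstant` of the venture `Summits/Ventures/Crystal3D` (cell `crystal3d-full`).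
Over the landed vocabulary `StickyWulffConstantLayerChainDefs` (p473239): `W_f = stackWulff f` is
closed, hence measurable; its volume is the integral over the height `y` of the area of the
section `stackSlice f y` (Cavalieri on `Fin 3 → ℝ ≃ ℝ × (Fin 2 → ℝ)`); and, with `y = √(2/3)·Z`,
the section areas satisfy the chamber-wise bounds of cf-p2 R19 (scaled areas × `√3`):
LOWER bounds `√3·A_f(Z) ≤ area(stackSlice f y)` on `|Z| ≤ 1`, `1 ≤ Z ≤ 3`, `−3 ≤ Z ≤ −1` from the
inner tent windows, and at `f = 0` the matching UPPER bounds from the outer facet windows, so that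
`area(stackSlice 0 y) = √3·A_0(Z)` exactly (`27/2 − Z²/2` resp. `6 + 3s + s²/4`, `s = 3 − |Z|`).
WHAT THIS IS NOT: the volume law itself (next file); nothing about the crux; rung F-C1 not moved.
-/

noncomputable section

namespace Summit.Ventures.Crystal3D.Theorems

open MeasureTheory Set
open Summit.Ventures.Crystal3D.LayerChain

/-- `W_f` is closed (an intersection of closed half-spaces). -/
theorem isClosed_stackWulff (f : ℝ) : IsClosed (stackWulff f) := by
  have : stackWulff f = ⋂ n : Fin 3 → ℝ, ⋂ τ : ℝ, {v | dot3 v n ≤ stackPhi f n τ} := by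
    ext v; simp [stackWulff]
  rw [this]
  refine isClosed_iInter fun n => isClosed_iInter fun τ => ?_
  have hc : Continuous fun v : Fin 3 → ℝ => dot3 v n := by unfold dot3; fun_prop
  exact isClosed_le hc continuous_const

/-- `W_f` is measurable. -/
theorem measurableSet_stackWulff (f : ℝ) : MeasurableSet (stackWulff f) :=
  (isClosed_stackWulff f).measurableSet

/-- **Cavalieri for `Fin 3 → ℝ` along the last coordinate.** The volume of a measurable set is the
integral over `y` of the planar measure of its section `{p | (p.1, p.2, y) ∈ W}`. -/
theorem volume_eq_lintegral_slice3 (W : Set (Fin 3 → ℝ)) (hW : MeasurableSet W) :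
    volume W = ∫⁻ y : ℝ, volume {p : ℝ × ℝ | (![p.1, p.2, y] : Fin 3 → ℝ) ∈ W} := by
  set Θ := MeasurableEquiv.piFinSuccAbove (fun _ : Fin 3 => ℝ) 2 with hΘ
  have hmp : MeasurePreserving Θ := volume_preserving_piFinSuccAbove (fun _ : Fin 3 => ℝ) 2
  have hmps : MeasurePreserving Θ.symm := hmp.symm
  have h1 : volume W = volume (Θ.symm ⁻¹' W) := (hmps.measure_preimage hW.nullMeasurableSet).symm
  rw [h1, Measure.volume_eq_prod, Measure.prod_apply (hW.preimage Θ.symm.measurable)]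
  congr 1
  funext y
  have h2 : MeasurePreserving (MeasurableEquiv.finTwoArrow (α := ℝ)) :=
    volume_preserving_finTwoArrow ℝ
  have hS : {p : ℝ × ℝ | (![p.1, p.2, y] : Fin 3 → ℝ) ∈ W} =
      (MeasurableEquiv.finTwoArrow (α := ℝ)).symm ⁻¹' (Prod.mk y ⁻¹' (Θ.symm ⁻¹' W)) := by
    ext p
    simp only [mem_setOf_eq, mem_preimage]
    have : Θ.symm (y, (MeasurableEquiv.finTwoArrow (α := ℝ)).symm p) = ![p.1, p.2, y] := by
      have e0 : (0 : Fin 3) = (2 : Fin 3).succAbove 0 := by decide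
      have e1 : (1 : Fin 3) = (2 : Fin 3).succAbove 1 := by decide
      ext i
      fin_cases i
      · simp only [hΘ, MeasurableEquiv.piFinSuccAbove_symm_apply, Fin.insertNthEquiv,
          MeasurableEquiv.finTwoArrow]
        simp
        rw [e0, Fin.insertNth_apply_succAbove]; simp
      · simp only [hΘ, MeasurableEquiv.piFinSuccAbove_symm_apply, Fin.insertNthEquiv,
          MeasurableEquiv.finTwoArrow]
        simp
        rw [e1, Fin.insertNth_apply_succAbove]; simp
      · simp [hΘ, MeasurableEquiv.piFinSuccAbove_symm_apply, Fin.insertNthEquiv,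
          MeasurableEquiv.finTwoArrow]
    rw [this]
  rw [hS]
  exact ((h2.symm.measure_preimage ((hW.preimage Θ.symm.measurable).preimage
    measurable_prodMk_left).nullMeasurableSet)).symm

/-- **Cavalieri for `W_f`.** `|W_f| = ∫ area(stackSlice f y) dy`. -/
theorem volume_stackWulff_eq_lintegral (f : ℝ) :
    volume (stackWulff f) = ∫⁻ y : ℝ, volume (stackSlice f y) :=
  volume_eq_lintegral_slice3 _ (measurableSet_stackWulff f)

/-! ### Exact section areas (physical = `√3 ×` the scaled areas of R19) -/

/-- Inner bound, chamber `|Z| ≤ 1`: `√3 (27/2 − ((1−2f)Z)²/2) ≤ area(stackSlice f (√(2/3) Z))`. -/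
theorem le_volume_stackSlice_mid (f Z : ℝ) (hf0 : 0 ≤ f) (hf1 : f ≤ 1) (hZ1 : -1 ≤ Z)
    (hZ2 : Z ≤ 1) :
    ENNReal.ofReal (Real.sqrt 3 * (27 / 2 - ((1 - 2 * f) * Z) ^ 2 / 2)) ≤
      volume (stackSlice f (Real.sqrt (2 / 3) * Z)) := by
  have h3 : Real.sqrt 3 * Real.sqrt 3 = 3 := Real.mul_self_sqrt (by norm_num)
  have hs : 0 < Real.sqrt 3 := Real.sqrt_pos.2 (by norm_num)
  have hw1 : -1 ≤ (1 - 2 * f) * Z := by nlinarith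
  have hw2 : (1 - 2 * f) * Z ≤ 1 := by nlinarith
  have hv := volume_tentWindow (Real.sqrt 3 * (-3 / 2 + (1 - 2 * f) * Z / 6))
    (Real.sqrt 3 * (3 / 2 + (1 - 2 * f) * Z / 6)) (Real.sqrt 3 * (-((1 - 2 * f) * Z / 3))) 3
    (Real.sqrt 3 / 3) (by nlinarith [hs]) (by nlinarith [hs]) (by positivity) (by nlinarith [h3, hs]) (by nlinarith [h3, hs])
  calc ENNReal.ofReal (Real.sqrt 3 * (27 / 2 - ((1 - 2 * f) * Z) ^ 2 / 2))
      = volume {p : ℝ × ℝ | Real.sqrt 3 * (-3 / 2 + (1 - 2 * f) * Z / 6) ≤ p.2 ∧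
          p.2 ≤ Real.sqrt 3 * (3 / 2 + (1 - 2 * f) * Z / 6) ∧
          |p.1| ≤ 3 - Real.sqrt 3 / 3 * |p.2 - Real.sqrt 3 * (-((1 - 2 * f) * Z / 3))|} := by
        rw [hv]; congr 1
        linear_combination (Real.sqrt 3 / 3 * ((3 / 2 - (1 - 2 * f) * Z / 2) ^ 2 + (3 / 2 + (1 - 2 * f) * Z / 2) ^ 2)) * h3
    _ ≤ volume (stackSlice f (Real.sqrt (2 / 3) * Z)) :=
        measure_mono (tentWindow_subset_stackSlice_mid f Z hf0 hf1 hZ1 hZ2)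

/-- Inner bound, chamber `1 ≤ Z ≤ 3` (`s = 3 − Z`, `g = f s`):
`√3 (6 + 3s + s²/4 + g(s−g)/2) ≤ area(stackSlice f (√(2/3) Z))`. -/
theorem le_volume_stackSlice_top (f Z : ℝ) (hf0 : 0 ≤ f) (hf1 : f ≤ 1) (hZ1 : 1 ≤ Z)
    (hZ2 : Z ≤ 3) :
    ENNReal.ofReal (Real.sqrt 3 * (6 + 3 * (3 - Z) + (3 - Z) ^ 2 / 4 +
        f * (3 - Z) * ((3 - Z) - f * (3 - Z)) / 2)) ≤
      volume (stackSlice f (Real.sqrt (2 / 3) * Z)) := by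
  have h3 : Real.sqrt 3 * Real.sqrt 3 = 3 := Real.mul_self_sqrt (by norm_num)
  have hs : 0 < Real.sqrt 3 := Real.sqrt_pos.2 (by norm_num)
  have hg0 : 0 ≤ f * (3 - Z) := mul_nonneg hf0 (by linarith)
  have hgs : f * (3 - Z) ≤ 3 - Z := by nlinarith
  have hv := volume_tentWindow (Real.sqrt 3 * (-1 - (3 - Z) / 6 - f * (3 - Z) / 6))
    (Real.sqrt 3 * (1 + (3 - Z) / 3 - f * (3 - Z) / 6))
    (Real.sqrt 3 * (-((3 - Z) / 6) + f * (3 - Z) / 3)) (2 + (3 - Z) / 2) (Real.sqrt 3 / 3)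
    (by nlinarith [hs]) (by nlinarith [hs]) (by positivity) (by nlinarith [h3, hs]) (by nlinarith [h3, hs])
  calc ENNReal.ofReal (Real.sqrt 3 * (6 + 3 * (3 - Z) + (3 - Z) ^ 2 / 4 +
        f * (3 - Z) * ((3 - Z) - f * (3 - Z)) / 2))
      = volume {p : ℝ × ℝ | Real.sqrt 3 * (-1 - (3 - Z) / 6 - f * (3 - Z) / 6) ≤ p.2 ∧
          p.2 ≤ Real.sqrt 3 * (1 + (3 - Z) / 3 - f * (3 - Z) / 6) ∧
          |p.1| ≤ (2 + (3 - Z) / 2) -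
            Real.sqrt 3 / 3 * |p.2 - Real.sqrt 3 * (-((3 - Z) / 6) + f * (3 - Z) / 3)|} := by
        rw [hv]; congr 1
        linear_combination (Real.sqrt 3 / 3 * ((1 + f * (3 - Z) / 2) ^ 2 + (1 + (3 - Z) / 2 - f * (3 - Z) / 2) ^ 2)) * h3
    _ ≤ volume (stackSlice f (Real.sqrt (2 / 3) * Z)) :=
        measure_mono (tentWindow_subset_stackSlice_top f Z hf0 hf1 hZ1 hZ2)

/-- Inner bound, chamber `−3 ≤ Z ≤ −1` (`s = 3 + Z`, `g = f s`). -/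
theorem le_volume_stackSlice_bot (f Z : ℝ) (hf0 : 0 ≤ f) (hf1 : f ≤ 1) (hZ1 : -3 ≤ Z)
    (hZ2 : Z ≤ -1) :
    ENNReal.ofReal (Real.sqrt 3 * (6 + 3 * (3 + Z) + (3 + Z) ^ 2 / 4 +
        f * (3 + Z) * ((3 + Z) - f * (3 + Z)) / 2)) ≤
      volume (stackSlice f (Real.sqrt (2 / 3) * Z)) := by
  have h3 : Real.sqrt 3 * Real.sqrt 3 = 3 := Real.mul_self_sqrt (by norm_num)
  have hs : 0 < Real.sqrt 3 := Real.sqrt_pos.2 (by norm_num)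
  have hg0 : 0 ≤ f * (3 + Z) := mul_nonneg hf0 (by linarith)
  have hgs : f * (3 + Z) ≤ 3 + Z := by nlinarith
  have hv := volume_tentWindow (Real.sqrt 3 * (-1 - (3 + Z) / 3 + f * (3 + Z) / 6))
    (Real.sqrt 3 * (1 + (3 + Z) / 6 + f * (3 + Z) / 6))
    (Real.sqrt 3 * ((3 + Z) / 6 - f * (3 + Z) / 3)) (2 + (3 + Z) / 2) (Real.sqrt 3 / 3)
    (by nlinarith [hs]) (by nlinarith [hs]) (by positivity) (by nlinarith [h3, hs]) (by nlinarith [h3, hs])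
  calc ENNReal.ofReal (Real.sqrt 3 * (6 + 3 * (3 + Z) + (3 + Z) ^ 2 / 4 +
        f * (3 + Z) * ((3 + Z) - f * (3 + Z)) / 2))
      = volume {p : ℝ × ℝ | Real.sqrt 3 * (-1 - (3 + Z) / 3 + f * (3 + Z) / 6) ≤ p.2 ∧
          p.2 ≤ Real.sqrt 3 * (1 + (3 + Z) / 6 + f * (3 + Z) / 6) ∧
          |p.1| ≤ (2 + (3 + Z) / 2) -
            Real.sqrt 3 / 3 * |p.2 - Real.sqrt 3 * ((3 + Z) / 6 - f * (3 + Z) / 3)|} := by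
        rw [hv]; congr 1
        linear_combination (Real.sqrt 3 / 3 * ((1 + (3 + Z) / 2 - f * (3 + Z) / 2) ^ 2 + (1 + f * (3 + Z) / 2) ^ 2)) * h3
    _ ≤ volume (stackSlice f (Real.sqrt (2 / 3) * Z)) :=
        measure_mono (tentWindow_subset_stackSlice_bot f Z hf0 hf1 hZ1 hZ2)

/-- Outer bound at `f = 0`, chamber `|Z| ≤ 1`: `area(stackSlice 0 (√(2/3) Z)) ≤ √3 (27/2 − Z²/2)`. -/
theorem volume_stackSlice_zero_le_mid' (Z : ℝ) (hZ1 : -3 ≤ Z) (hZ2 : Z ≤ 3) :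
    volume (stackSlice 0 (Real.sqrt (2 / 3) * Z)) ≤
      ENNReal.ofReal (Real.sqrt 3 * (27 / 2 - Z ^ 2 / 2)) := by
  have h3 : Real.sqrt 3 * Real.sqrt 3 = 3 := Real.mul_self_sqrt (by norm_num)
  have hs : 0 < Real.sqrt 3 := Real.sqrt_pos.2 (by norm_num)
  have hv := volume_tentWindow (Real.sqrt 3 * (-3 / 2 + Z / 6)) (Real.sqrt 3 * (3 / 2 + Z / 6))
    (Real.sqrt 3 * (-(Z / 3))) 3 (Real.sqrt 3 / 3)
    (by nlinarith [hs]) (by nlinarith [hs]) (by positivity) (by nlinarith [h3, hs]) (by nlinarith [h3, hs])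
  calc volume (stackSlice 0 (Real.sqrt (2 / 3) * Z))
      ≤ volume {p : ℝ × ℝ | Real.sqrt 3 * (-3 / 2 + Z / 6) ≤ p.2 ∧
          p.2 ≤ Real.sqrt 3 * (3 / 2 + Z / 6) ∧
          |p.1| ≤ 3 - Real.sqrt 3 / 3 * |p.2 - Real.sqrt 3 * (-(Z / 3))|} :=
        measure_mono (stackSlice_zero_subset_mid Z)
    _ = ENNReal.ofReal (Real.sqrt 3 * (27 / 2 - Z ^ 2 / 2)) := by
        rw [hv]; congr 1
        linear_combination (-(Real.sqrt 3 / 3 * ((3 / 2 - Z / 2) ^ 2 + (3 / 2 + Z / 2) ^ 2))) * h3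

/-- Outer bound at `f = 0`, chamber `1 ≤ Z ≤ 3`: `area ≤ √3 (6 + 3s + s²/4)`, `s = 3 − Z`. -/
theorem volume_stackSlice_zero_le_top' (Z : ℝ) (hZ1 : 1 ≤ Z) (hZ2 : Z ≤ 3) :
    volume (stackSlice 0 (Real.sqrt (2 / 3) * Z)) ≤
      ENNReal.ofReal (Real.sqrt 3 * (6 + 3 * (3 - Z) + (3 - Z) ^ 2 / 4)) := by
  have h3 : Real.sqrt 3 * Real.sqrt 3 = 3 := Real.mul_self_sqrt (by norm_num)
  have hs : 0 < Real.sqrt 3 := Real.sqrt_pos.2 (by norm_num)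
  have hv := volume_tentWindow (Real.sqrt 3 * (-3 / 2 + Z / 6)) (Real.sqrt 3 * (2 - Z / 3))
    (Real.sqrt 3 * (-1 / 2 + Z / 6)) (7 / 2 - Z / 2) (Real.sqrt 3 / 3)
    (by nlinarith [hs]) (by nlinarith [hs]) (by positivity) (by nlinarith [h3, hs]) (by nlinarith [h3, hs])
  calc volume (stackSlice 0 (Real.sqrt (2 / 3) * Z))
      ≤ volume {p : ℝ × ℝ | Real.sqrt 3 * (-3 / 2 + Z / 6) ≤ p.2 ∧
          p.2 ≤ Real.sqrt 3 * (2 - Z / 3) ∧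
          |p.1| ≤ (7 / 2 - Z / 2) - Real.sqrt 3 / 3 * |p.2 - Real.sqrt 3 * (-1 / 2 + Z / 6)|} :=
        measure_mono (stackSlice_zero_subset_top Z)
    _ = ENNReal.ofReal (Real.sqrt 3 * (6 + 3 * (3 - Z) + (3 - Z) ^ 2 / 4)) := by
        rw [hv]; congr 1
        linear_combination (-(Real.sqrt 3 / 3 * (1 + (1 + (3 - Z) / 2) ^ 2))) * h3

/-- Outer bound at `f = 0`, chamber `−3 ≤ Z ≤ −1`: `area ≤ √3 (6 + 3s + s²/4)`, `s = 3 + Z`. -/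
theorem volume_stackSlice_zero_le_bot' (Z : ℝ) (hZ1 : -3 ≤ Z) (hZ2 : Z ≤ -1) :
    volume (stackSlice 0 (Real.sqrt (2 / 3) * Z)) ≤
      ENNReal.ofReal (Real.sqrt 3 * (6 + 3 * (3 + Z) + (3 + Z) ^ 2 / 4)) := by
  have h3 : Real.sqrt 3 * Real.sqrt 3 = 3 := Real.mul_self_sqrt (by norm_num)
  have hs : 0 < Real.sqrt 3 := Real.sqrt_pos.2 (by norm_num)
  have hv := volume_tentWindow (Real.sqrt 3 * (-2 - Z / 3)) (Real.sqrt 3 * (3 / 2 + Z / 6))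
    (Real.sqrt 3 * (1 / 2 + Z / 6)) (7 / 2 + Z / 2) (Real.sqrt 3 / 3)
    (by nlinarith [hs]) (by nlinarith [hs]) (by positivity) (by nlinarith [h3, hs]) (by nlinarith [h3, hs])
  calc volume (stackSlice 0 (Real.sqrt (2 / 3) * Z))
      ≤ volume {p : ℝ × ℝ | Real.sqrt 3 * (-2 - Z / 3) ≤ p.2 ∧
          p.2 ≤ Real.sqrt 3 * (3 / 2 + Z / 6) ∧
          |p.1| ≤ (7 / 2 + Z / 2) - Real.sqrt 3 / 3 * |p.2 - Real.sqrt 3 * (1 / 2 + Z / 6)|} :=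
        measure_mono (stackSlice_zero_subset_bot Z)
    _ = ENNReal.ofReal (Real.sqrt 3 * (6 + 3 * (3 + Z) + (3 + Z) ^ 2 / 4)) := by
        rw [hv]; congr 1
        linear_combination (-(Real.sqrt 3 / 3 * ((1 + (3 + Z) / 2) ^ 2 + 1))) * h3

/-- Exact section area of `W_0`, chamber `|Z| ≤ 1`. -/
theorem volume_stackSlice_zero_mid (Z : ℝ) (hZ1 : -1 ≤ Z) (hZ2 : Z ≤ 1) :
    volume (stackSlice 0 (Real.sqrt (2 / 3) * Z)) =
      ENNReal.ofReal (Real.sqrt 3 * (27 / 2 - Z ^ 2 / 2)) := by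
  refine le_antisymm (volume_stackSlice_zero_le_mid' Z (by linarith) (by linarith)) ?_
  have h := le_volume_stackSlice_mid 0 Z le_rfl zero_le_one hZ1 hZ2
  refine le_trans (le_of_eq ?_) h
  congr 1; ring

/-- Exact section area of `W_0`, chamber `1 ≤ Z ≤ 3`. -/
theorem volume_stackSlice_zero_top (Z : ℝ) (hZ1 : 1 ≤ Z) (hZ2 : Z ≤ 3) :
    volume (stackSlice 0 (Real.sqrt (2 / 3) * Z)) =
      ENNReal.ofReal (Real.sqrt 3 * (6 + 3 * (3 - Z) + (3 - Z) ^ 2 / 4)) := by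
  refine le_antisymm (volume_stackSlice_zero_le_top' Z hZ1 hZ2) ?_
  have h := le_volume_stackSlice_top 0 Z le_rfl zero_le_one hZ1 hZ2
  refine le_trans (le_of_eq ?_) h
  congr 1; ring

/-- Exact section area of `W_0`, chamber `−3 ≤ Z ≤ −1`. -/
theorem volume_stackSlice_zero_bot (Z : ℝ) (hZ1 : -3 ≤ Z) (hZ2 : Z ≤ -1) :
    volume (stackSlice 0 (Real.sqrt (2 / 3) * Z)) =
      ENNReal.ofReal (Real.sqrt 3 * (6 + 3 * (3 + Z) + (3 + Z) ^ 2 / 4)) := by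
  refine le_antisymm (volume_stackSlice_zero_le_bot' Z hZ1 hZ2) ?_
  have h := le_volume_stackSlice_bot 0 Z le_rfl zero_le_one hZ1 hZ2
  refine le_trans (le_of_eq ?_) h
  congr 1; ring

end Summit.Ventures.Crystal3D.Theorems

end
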